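import Summits.KontsevichZagierPeriods.KontsevichZagierPeriods.Theorems.EllipticMomentKernel.Negative.GeneralCurve
import Summits.KontsevichZagierPeriods.KontsevichZagierPeriods.Theorems.HermiteRigidityEllipticMomentKernelStubSigmaRep
import Literature.NumberTheory.Transcendental.KZLogCalculusProofs

/-!
# `EllipticMomentKernel` (stmt-KontsevichZagierPeriods-10631), line `merge-first-single-hermite`:
# stub `stub_hermiteExactForm`
# (= support item `HermiteExactFormVanishes`, stmt-KontsevichZagierPeriods-3412, verbatim)

ONE HERMITE STEP AS A KZ MOVE. For a rational Weierstrass cubic `f = cubic q₂ q₃ = 4x³ − q₂x − q₃`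
with `disc > 0` (three real roots `e₃ < e₂ < e₁`, bounded oval `σ = oval q₂ q₃ = (e₃, e₂)`) and
any `P ∈ ℚ[X]`, every representation `[σ, (P′f + Pf′/2)/√f]` of the Hermite exact form lies in
`KZ.relations`:

* ONE Newton–Leibniz move (KZ rule (3), `KZ.newtonLeibnizRel`) over the point `ℝ⁰` on the
  CLOSED band `[e₃, e₂] ⊆ ℝ¹` — the ends `e₃, e₂` are real ALGEBRAIC numbers, hence
  `ℚ`-semialgebraic constants — with the `ℚ`-semialgebraic primitive `F = P·√f`, continuous on
  `[e₃, e₂]`, with derivative the (unbounded, integrable) exact form on `(e₃, e₂)` and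
  `F(e₂) − F(e₃) = 0 − 0 = 0`; the band integrand is the exact form `D(P)/√f`, whose displayed
  formula already takes the junk value `0` at the two roots (`x/√0 = x/0 = 0`), so it is
  `ℚ`-semialgebraic on the closed band by gluing (`IsSemialgebraicFunOn.union`) and integrable
  there because the two ends are null;
* the base `[pt, 0]` has zero integrand, hence is a relation;
* closed band versus open oval is ONE domain-additivity move (`KZ.domainAddRel`) with the null
  two-point representation on `{e₃, e₂}`, itself a relation;
* the GIVEN representation `r` on `σ` is congruent to ours (same domain, integrands agree on it).

This is the model instance `hermiteElem_mem_relations` (Negative/HermiteMove.lean, `P = 1` on the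
curve `(4, 0)`) with the rational ends `−1, 0` generalised to the algebraic `e₃, e₂` and the
primitive `√f/2` to `P√f`.
-/

noncomputable section

open MeasureTheory Set
open scoped Polynomial

namespace Summit.KontsevichZagierPeriods.HermiteRigidity.EllipticMomentKernel

open Literature.NumberTheory.Transcendental
open Literature.NumberTheory.Transcendental.KZ
open Summit.KontsevichZagierPeriods.HermiteRigidity.EllipticMomentKernelNegative
open Summit.KontsevichZagierPeriods.KontsevichZagierPeriods.Theses.HermiteRigidity
  (EllipticMomentKernel HermiteExactFormVanishes)
open Literature.ModelTheory.ExponentialFields (IsSemialgebraic isSemialgebraic_univ)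

/-! ## Calculus of the primitive `P√f` -/

/-- The Hermite numerator `D(P) = P′·f + P·f′/2 ∈ ℚ[X]` of the cubic `f = 4X³ − q₂X − q₃`,
evaluated at a real point. [folklore] -/
theorem hermiteExactForm_aeval_numerator (q₂ q₃ : ℚ) (P : ℚ[X]) (x : ℝ) :
    (Polynomial.aeval x (Polynomial.derivative P *
        (4 * Polynomial.X ^ 3 - Polynomial.C q₂ * Polynomial.X - Polynomial.C q₃) +
        P * (Polynomial.C (1 / 2 : ℚ) * (12 * Polynomial.X ^ 2 - Polynomial.C q₂))) : ℝ) =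
      (Polynomial.aeval x (Polynomial.derivative P) : ℝ) * cubic q₂ q₃ x +
        (Polynomial.aeval x P : ℝ) * (12 * x ^ 2 - (q₂ : ℝ)) / 2 := by
  simp only [map_add, map_mul, Polynomial.aeval_C, eq_ratCast, map_sub, map_pow,
    Polynomial.aeval_X, map_ofNat, cubic]
  push_cast
  ring

/-- A real root of the rational Weierstrass cubic `4x³ − q₂x − q₃` is algebraic over `ℚ` (it is a
root of the non-zero `4X³ − q₂X − q₃ ∈ ℚ[X]`). [folklore] -/
theorem hermiteExactForm_isAlgebraic_root {q₂ q₃ : ℚ} {e : ℝ} (he : cubic q₂ q₃ e = 0) :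
    IsAlgebraic ℚ e := by
  refine ⟨4 * Polynomial.X ^ 3 - Polynomial.C q₂ * Polynomial.X - Polynomial.C q₃,
    fun h => ?_, ?_⟩
  · have h3 := congrArg (fun p : ℚ[X] => p.coeff 3) h
    simp at h3
  · simp only [map_sub, map_mul, map_ofNat, map_pow, Polynomial.aeval_X, Polynomial.aeval_C,
      eq_ratCast]
    simpa [cubic] using he

/-- The derivative of the cubic: `f′(x) = 12x² − q₂`. [folklore] -/
theorem hermiteExactForm_hasDerivAt_cubic (q₂ q₃ : ℚ) (x : ℝ) :
    HasDerivAt (cubic q₂ q₃) (12 * x ^ 2 - (q₂ : ℝ)) x := by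
  have h : cubic q₂ q₃ = fun x : ℝ => 4 * x ^ 3 - (q₂ : ℝ) * x - (q₃ : ℝ) := rfl
  rw [h]
  have h1 : HasDerivAt (fun x : ℝ => 4 * x ^ 3) (4 * (3 * x ^ 2)) x := by
    simpa using (hasDerivAt_pow 3 x).const_mul 4
  have h2 : HasDerivAt (fun x : ℝ => (q₂ : ℝ) * x) ((q₂ : ℝ) * 1) x :=
    (hasDerivAt_id x).const_mul (q₂ : ℝ)
  exact ((h1.sub h2).sub_const (q₃ : ℝ)).congr_deriv (by ring)

/-- **`P√f` is a primitive of the Hermite exact form** where `f > 0`: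
`d/dx (P(x)√f(x)) = (P′(x) f(x) + P(x) f′(x)/2)/√f(x)`. [cite: BostanLairezSalvy2013, §1] -/
theorem hermiteExactForm_hasDerivAt {q₂ q₃ : ℚ} (P : ℚ[X]) {x : ℝ} (hx : 0 < cubic q₂ q₃ x) :
    HasDerivAt (fun s => (Polynomial.aeval s P : ℝ) * Real.sqrt (cubic q₂ q₃ s))
      (((Polynomial.aeval x (Polynomial.derivative P) : ℝ) * cubic q₂ q₃ x +
        (Polynomial.aeval x P : ℝ) * (12 * x ^ 2 - (q₂ : ℝ)) / 2) /
        Real.sqrt (cubic q₂ q₃ x)) x := by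
  have h1 : HasDerivAt (fun s => (Polynomial.aeval s P : ℝ))
      (Polynomial.aeval x (Polynomial.derivative P)) x := Polynomial.hasDerivAt_aeval P x
  have h2 := (hermiteExactForm_hasDerivAt_cubic q₂ q₃ x).sqrt hx.ne'
  refine (h1.mul h2).congr_deriv ?_
  have hss : Real.sqrt (cubic q₂ q₃ x) * Real.sqrt (cubic q₂ q₃ x) = cubic q₂ q₃ x :=
    Real.mul_self_sqrt hx.le
  field_simp
  linear_combination (2 * (Polynomial.aeval x (Polynomial.derivative P) : ℝ)) * hss

/-! ## The move, in the `cubic`/`oval` vocabulary -/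

/-- **One Hermite step as a KZ move** (`cubic`/`oval` vocabulary): for `disc > 0` and `P ∈ ℚ[X]`,
every representation `r = [σ, (P′f + Pf′/2)/√f]` lies in `KZ.relations` — one Newton–Leibniz move
over `ℝ⁰` on the closed band `[e₃, e₂]` (algebraic ends) with primitive `P√f` onto `[pt, 0]`,
one domain-additivity move closed band = `σ ∪ {e₃, e₂}` (null ends), and the congruence with `r`.
[cite: KontsevichZagier2001, §1.2 rule (3)] [cite: BostanLairezSalvy2013, §1] -/
theorem hermiteExactForm_of_mem_relations {q₂ q₃ : ℚ} (hΔ : 0 < disc q₂ q₃) (P : ℚ[X])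
    (r : IntegralRep 1) (hr : r.domain = oval q₂ q₃)
    (hri : EqOn r.integrand (fun p =>
      ((Polynomial.aeval (p 0) (Polynomial.derivative P) : ℝ) * cubic q₂ q₃ (p 0) +
        (Polynomial.aeval (p 0) P : ℝ) * (12 * (p 0) ^ 2 - (q₂ : ℝ)) / 2) /
        Real.sqrt (cubic q₂ q₃ (p 0))) (oval q₂ q₃)) :
    KZ.of r ∈ KZ.relations := by
  obtain ⟨e₃, e₂, e₁, h3, h2a, h2b, h1, hf⟩ := exists_roots hΔ
  have h32 : e₃ < e₂ := by linarith
  have h21 : e₂ < e₁ := by linarith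
  have he₃ : cubic q₂ q₃ e₃ = 0 := by rw [hf]; ring
  have he₂ : cubic q₂ q₃ e₂ = 0 := by rw [hf]; ring
  have ha₃ : IsAlgebraic ℚ e₃ := hermiteExactForm_isAlgebraic_root he₃
  have ha₂ : IsAlgebraic ℚ e₂ := hermiteExactForm_isAlgebraic_root he₂
  have hσ : oval q₂ q₃ = {p | p 0 ∈ Ioo e₃ e₂} := oval_eq_of_roots h32 h21 hf
  have hpos : ∀ x ∈ Ioo e₃ e₂, 0 < cubic q₂ q₃ x := (cubic_sign_of_roots h32 h21 hf).1
  -- the Hermite numerator `E = D(P)` and the exact form `g = E/√f` (junk value `0` at the roots)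
  set E : ℚ[X] := Polynomial.derivative P *
      (4 * Polynomial.X ^ 3 - Polynomial.C q₂ * Polynomial.X - Polynomial.C q₃) +
    P * (Polynomial.C (1 / 2 : ℚ) * (12 * Polynomial.X ^ 2 - Polynomial.C q₂))
  set g : (Fin 1 → ℝ) → ℝ := fun p =>
    (Polynomial.aeval (p 0) E : ℝ) / Real.sqrt (cubic q₂ q₃ (p 0)) with hg
  -- the two ends and the closed band `[e₃, e₂] ⊆ ℝ¹` in the literal shape of rule (3) over `ℝ⁰`
  set ends : Set (Fin 1 → ℝ) := {z | z 0 = e₃} ∪ {z | z 0 = e₂} with hends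
  set band : Set (Fin 1 → ℝ) :=
    KZlog.band (univ : Set (Fin 0 → ℝ)) (fun _ => e₃) (fun _ => e₂) with hband
  have hends_sa : IsSemialgebraic ℚ ends :=
    (isSemialgebraic_setOf_apply_eq_of_isAlgebraic ha₃ 0).union
      (isSemialgebraic_setOf_apply_eq_of_isAlgebraic ha₂ 0)
  have hends_vol : volume ends = 0 := by
    have : ends = {fun _ => e₃, fun _ => e₂} := by
      ext z; simp [hends, funext_iff, Fin.forall_fin_one]
    rw [this]
    exact (Set.toFinite _).measure_zero _
  have ha_sa : IsSemialgebraicFunOn ℚ (univ : Set (Fin 0 → ℝ)) (fun _ => e₃) :=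
    isSemialgebraicFunOn_const_of_isAlgebraic isSemialgebraic_univ ha₃
  have hb_sa : IsSemialgebraicFunOn ℚ (univ : Set (Fin 0 → ℝ)) (fun _ => e₂) :=
    isSemialgebraicFunOn_const_of_isAlgebraic isSemialgebraic_univ ha₂
  have hband_sa : IsSemialgebraic ℚ band := KZlog.isSemialgebraic_band ha_sa hb_sa
  have hband_eq : band = oval q₂ q₃ ∪ ends := by
    rw [hσ]
    ext z
    simp only [hband, KZlog.mem_band, mem_univ, true_and, hends, mem_union, mem_setOf_eq, mem_Ioo,
      Fin.last_zero]
    constructor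
    · rintro ⟨hl, hu⟩
      rcases hl.lt_or_eq with hl | hl
      · rcases hu.lt_or_eq with hu | hu
        · exact Or.inl ⟨hl, hu⟩
        · exact Or.inr (Or.inr hu)
      · exact Or.inr (Or.inl hl.symm)
    · rintro (⟨hl, hu⟩ | h | h)
      · exact ⟨hl.le, hu.le⟩
      · rw [h]; exact ⟨le_rfl, h32.le⟩
      · rw [h]; exact ⟨h32.le, le_rfl⟩
  -- at the two roots the displayed exact form is literally `0` (`x/√0 = x/0 = 0`)
  have hg_ends : ∀ z ∈ ends, g z = 0 := by
    intro z hz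
    have h0 : cubic q₂ q₃ (z 0) = 0 := by
      rcases hz with h | h
      · rw [show z 0 = e₃ from h, he₃]
      · rw [show z 0 = e₂ from h, he₂]
    simp [hg, h0]
  -- semialgebraicity of `g` on the closed band: glue `σ` (carrier helper) and the ends (constant 0)
  have hg_oval : IsSemialgebraicFunOn ℚ (oval q₂ q₃) g :=
    sigmaRep_isSemialgebraicFunOn_aeval_div_sqrt hΔ E
  have hg_endsSA : IsSemialgebraicFunOn ℚ ends g :=
    (isSemialgebraicFunOn_ratCast hends_sa 0).congr fun z hz => by
      rw [hg_ends z hz]; simp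
  have hg_band : IsSemialgebraicFunOn ℚ band g := by
    rw [hband_eq]
    exact hg_oval.union hg_endsSA (fun _ _ => rfl) (fun _ _ => rfl)
  -- integrability of `g` on the closed band: `σ` (carrier helper) and the null ends
  have hgi_oval : IntegrableOn g (oval q₂ q₃) := sigmaRep_integrableOn_aeval_div_sqrt hΔ E
  have hgi_ends : IntegrableOn g ends := by
    rw [IntegrableOn, Measure.restrict_eq_zero.2 hends_vol]
    exact integrable_zero_measure
  have hgi_band : IntegrableOn g band := by
    rw [hband_eq]; exact hgi_oval.union hgi_ends
  -- the band representation `R = [[e₃,e₂], g]`, the ends `N = [{e₃,e₂}, g]`, the base `Z = [pt, 0]`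
  obtain ⟨R, hRd, hRi⟩ : ∃ R : IntegralRep 1, R.domain = band ∧ R.integrand = g :=
    ⟨{ domain := band
       integrand := g
       isSemialgebraic_domain := hband_sa
       isSemialgebraicFunOn_integrand := hg_band
       integrableOn := hgi_band }, rfl, rfl⟩
  obtain ⟨N, hNd, hNi⟩ : ∃ N : IntegralRep 1, N.domain = ends ∧ N.integrand = g :=
    ⟨{ domain := ends
       integrand := g
       isSemialgebraic_domain := hends_sa
       isSemialgebraicFunOn_integrand := hg_endsSA
       integrableOn := hgi_ends }, rfl, rfl⟩
  obtain ⟨Z, hZd, hZi⟩ : ∃ Z : IntegralRep 0, Z.domain = univ ∧ Z.integrand = 0 :=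
    exists_zeroRep isSemialgebraic_univ
  have hs0 : ∀ (x : Fin 0 → ℝ) (t : ℝ), (Fin.snoc x t : Fin 1 → ℝ) 0 = t := fun _ _ => rfl
  -- (i) ONE Newton–Leibniz move over `ℝ⁰`: `[R] − [Z] ∈ newtonLeibnizRel`, primitive `F = P√f`
  have hNL : KZ.of R - KZ.of Z ∈ newtonLeibnizRel := by
    refine ⟨0, R, Z, fun _ => e₃, fun _ => e₂,
      fun z => (Polynomial.aeval (z 0) P : ℝ) * Real.sqrt (cubic q₂ q₃ (z 0)),
      ?_, ?_, ?_, fun _ _ => h32.le, ?_, ?_, ?_, ?_, rfl⟩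
    · -- `F = P(x)·√f(x)` is `ℚ`-semialgebraic on the band
      rw [hRd]
      have hP : IsSemialgebraicFunOn ℚ band (fun z => (Polynomial.aeval (z 0) P : ℝ)) :=
        (isSemialgebraicFunOn_aeval hband_sa
          (Polynomial.aeval (MvPolynomial.X 0 : MvPolynomial (Fin 1) ℚ) P)).congr fun z _ => by
          simp only
          rw [← Polynomial.aeval_algHom_apply, MvPolynomial.aeval_X]
      have hS : IsSemialgebraicFunOn ℚ band (fun z => Real.sqrt (cubic q₂ q₃ (z 0))) :=
        (IsSemialgebraicFunOn.sqrt_holds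
          (isSemialgebraicFunOn_aeval hband_sa (cubicPolyQ q₂ q₃))).congr
          fun z _ => by simp only [aeval_cubicPolyQ]
      exact (IsSemialgebraicFunOn.mul_holds hP hS).congr fun _ _ => rfl
    · rw [hZd]; exact ha_sa
    · rw [hZd]; exact hb_sa
    · rw [hRd, hZd, hband]; rfl
    · -- continuity of `t ↦ P(t)√f(t)` on the CLOSED fibre `[e₃, e₂]`
      intro x _
      simp only [hs0]
      exact ((Polynomial.continuous_aeval P).mul
        (Real.continuous_sqrt.comp continuous_cubic)).continuousOn
    · -- derivative the exact form on the OPEN fibre `(e₃, e₂)`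
      intro x _ t ht
      rw [hRi]
      simp only [hs0, hg]
      rw [hermiteExactForm_aeval_numerator]
      exact hermiteExactForm_hasDerivAt P (hpos t ht)
    · -- `F(e₂) − F(e₃) = P(e₂)·√0 − P(e₃)·√0 = 0`
      intro x _
      rw [hZi]
      simp only [hs0, Pi.zero_apply, he₃, he₂, Real.sqrt_zero, mul_zero, sub_zero]
  -- (ii) the base `[pt, 0]` and the null ends are relations, hence so is `[R]`
  have hZ : KZ.of Z ∈ relations :=
    of_mem_relations_of_eqOn_zero Z (by rw [hZi]; exact fun _ _ => rfl)
  have hN : KZ.of N ∈ relations :=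
    of_mem_relations_of_volume_eq_zero N (by rw [hNd]; exact hends_vol)
  have hR : KZ.of R ∈ relations := by
    have h := relations.add_mem (newtonLeibnizRel_subset_relations hNL) hZ
    rwa [sub_add_cancel] at h
  -- (iii) closed band versus open oval: ONE domain-additivity move `[R] − [r] − [N]`
  have hDA : KZ.of R - KZ.of r - KZ.of N ∈ domainAddRel := by
    refine ⟨1, R, r, N, by rw [hRd, hr, hNd, hband_eq], ?_, ?_, ?_, rfl⟩
    · rw [hr, hNd]; exact measure_mono_null inter_subset_right hends_vol
    · rw [hr, hRi]
      intro p hp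
      rw [hri hp]
      simp only [hg]
      rw [hermiteExactForm_aeval_numerator]
    · rw [hRi, hNi]; exact fun _ _ => rfl
  have : KZ.of r = KZ.of R - (KZ.of R - KZ.of r - KZ.of N) - KZ.of N := by abel
  rw [this]
  exact relations.sub_mem (relations.sub_mem hR (domainAddRel_subset_relations hDA)) hN

/-! ## The stub -/

/-- **Stub `stub_hermiteExactForm`** = the route's support item `HermiteExactFormVanishes`
(stmt-KontsevichZagierPeriods-3412) VERBATIM: for every rational cubic `f = 4x³ − q₂x − q₃` with
`q₂³ − 27q₃² > 0` and every `P ∈ ℚ[X]`, every representation `[σ, (P′f + Pf′/2)/√f]` on the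
bounded oval `σ` lies in `KZ.relations` — one Newton–Leibniz move over the point `ℝ⁰` on the CLOSED
band `[e₃, e₂]` (algebraic, hence `ℚ`-definable, ends) with the semialgebraic primitive `P√f`,
continuous on `[e₃, e₂]`, vanishing at both ends, derivative the (unbounded, integrable) integrand
on `(e₃, e₂)`; then closed band versus open `σ` (null ends) and the zero constant. The statement's
`f`, `σ` and hypothesis are definitionally `cubic q₂ q₃`, `oval q₂ q₃`, `0 < disc q₂ q₃`.
[cite: KontsevichZagier2001, §1.2 rule (3)] [cite: BostanLairezSalvy2013, §1] -/
theorem stub_hermiteExactForm : HermiteExactFormVanishes := by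
  intro q₂ q₃ hΔ P f σ r hr hri
  exact hermiteExactForm_of_mem_relations hΔ P r hr hri

end Summit.KontsevichZagierPeriods.HermiteRigidity.EllipticMomentKernel
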